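import Literature.MathematicalPhysics.PowerSystems.LuriePostnikovSlabPositivity

/-!
# The Lur'e–Postnikov slab LMI in SCHUR-COMPLEMENT form when `C·B = 0` (split presentations): one
# `|states| × |states|` matrix fact instead of a `(|states| + |channels|)`-dimensional one

Cell `gridfusion` (LADDER-GRIDFUSION G2.c lossy Lur'e tier; kernel lane for the 39-bus lossy split object, whose
certificate matrix `−𝓛` is `219 × 219` with a dense `109 × 109` principal block — beyond a monolithic in-kernel
`LDLᵀ`); seat gridfusion-lit-6 (g10).  Receptacles: `LuriePostnikovSlabCertificate.lean` (`slabL11/slabL12/slabL22/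
slabMatrix`, `SlabCertificate`) and `LuriePostnikovSlabPositivity.lean` (`LPSlabCertificate`).

THE OBSERVATION.  On every presentation whose output matrix reads positions and whose input matrix feeds speeds —
Pai's SPLIT forms (3.43)–(3.45) (`InternalNode.toSplitLurie`, `toSplitLurieLines`; all the WSCC9 / K2A / NE39 split
objects of the cell) — one has `C·B = 0` EXACTLY, so the channel block of the certificate matrix is diagonal:
`L₂₂ = −diag(τ)` (`slabL22_eq_of_C_mul_B`), i.e.

  `−𝓛 = [[X, Y], [Yᵀ, diag τ]]`,  `X = −L₁₁`,  `Y = −L₁₂`  (`neg_slabMatrix_eq_fromBlocks_of_C_mul_B`).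

If every multiplier `τ_k` is POSITIVE (free to arrange: on a channel with `C_k = 0` the value of `τ_k` does not enter
`X` or `Y` at all, and a strictly feasible certificate has `τ_k > 0` on the others), the Schur-complement criterion
[BoydVandenberghe2004 §A.5.5; HornJohnson2013 Thm 7.7.7; Mathlib `Matrix.PosDef.fromBlocks₂₂`] gives

  `−𝓛 ⪰ 0  ⟸  X − Y·diag(τ)⁻¹·Yᵀ ⪰ 0`   (`neg_slabMatrix_posSemidef_of_schur`),

a matrix fact of the size of the STATE space only (`19 × 19` for the 39-bus object instead of `219 × 219`), with
rational entries when the data are rational — decidable by the tree's `PSD.LDLCert` in seconds.  `SlabCertificate.ofSchur`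
and `LPSlabCertificate.ofSchur` are the corresponding constructors (all other fields as in the receptacles).  The
converse direction (`⇒`) also holds (it is an `↔` in Mathlib) but is not needed by producers.

THREE COLUMNS.  CERTIFIED: nothing by itself — this is certificate-CHECKING infrastructure (a sufficient condition for the
`lmi` field); the instances carry the model sentences.  No definition of a model; no named fact; standard axioms.
[cite: BoydVandenberghe2004, §A.5.5 (Schur complement, eq. (A.14)); HornJohnson2013, §7.7 Theorem 7.7.7; Pai1981, §2.16 eq. (2.64), §3.6.3 eqs. (3.43)–(3.45)]
-/

noncomputable section

open Matrix

namespace Literature.MathematicalPhysics.PowerSystems.LyapunovFunctionFamily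

variable {ι κ : Type*} [Fintype ι] [Fintype κ] [DecidableEq ι] [DecidableEq κ]
variable (S : System ι κ)

/-! ### The channel block is diagonal when `C·B = 0` -/

omit [DecidableEq ι] in
/-- On a presentation with `C·B = 0` the channel block of the certificate matrix is `−diag(τ)`.
[cite: Pai1981, §2.16 eq. (2.64) (third equation), §3.6.3 eq. (3.45)] -/
theorem slabL22_eq_of_C_mul_B (hCB : S.C * S.B = 0) (lam τ : κ → ℝ) :
    slabL22 S lam τ = -Matrix.diagonal τ := by
  simp [slabL22, hCB]

/-- Hence `−𝓛 = [[−L₁₁, −L₁₂], [(−L₁₂)ᵀ, diag τ]]`. [cite: Pai1981, §2.16 eq. (2.64)] -/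
theorem neg_slabMatrix_eq_fromBlocks_of_C_mul_B (hCB : S.C * S.B = 0) (P : Matrix ι ι ℝ) (η : ℝ)
    (lam τ a b : κ → ℝ) :
    -slabMatrix S P η lam τ a b =
      Matrix.fromBlocks (-slabL11 S P η τ a b) (-slabL12 S P lam τ a b) (-slabL12 S P lam τ a b)ᵀ
        (Matrix.diagonal τ) := by
  rw [slabMatrix, slabL22_eq_of_C_mul_B S hCB, Matrix.fromBlocks_neg, transpose_neg, neg_neg]

/-! ### The Schur-complement criterion -/

/-- The SCHUR COMPLEMENT of the channel block: `X − Y·diag(τ)⁻¹·Yᵀ` with `X = −L₁₁`, `Y = −L₁₂` (equivalently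
`−L₁₁ − L₁₂·diag(τ⁻¹)·L₁₂ᵀ`; a `|ι| × |ι|` matrix). [cite: BoydVandenberghe2004, §A.5.5 eq. (A.14)] -/
def slabSchur (P : Matrix ι ι ℝ) (η : ℝ) (lam τ a b : κ → ℝ) : Matrix ι ι ℝ :=
  -slabL11 S P η τ a b - slabL12 S P lam τ a b * Matrix.diagonal (fun k => (τ k)⁻¹) * (slabL12 S P lam τ a b)ᵀ

omit [Fintype κ] in
/-- `diag(τ)` with positive entries is positive definite (plumbing). [cite: HornJohnson2013, §7.1 Observation 7.1.2] -/
private theorem posDef_diagonal_of_pos {τ : κ → ℝ} (hτ : ∀ k, 0 < τ k) : (Matrix.diagonal τ).PosDef :=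
  Matrix.posDef_diagonal_iff.2 hτ

/-- `diag(τ)⁻¹ = diag(τ⁻¹)` for positive `τ` (plumbing). [cite: HornJohnson2013, §0.9.1] -/
private theorem inv_diagonal_of_pos {τ : κ → ℝ} (hτ : ∀ k, 0 < τ k) :
    (Matrix.diagonal τ)⁻¹ = Matrix.diagonal (fun k => (τ k)⁻¹) := by
  refine Matrix.inv_eq_left_inv ?_
  rw [Matrix.diagonal_mul_diagonal, ← Matrix.diagonal_one]
  congr 1; funext k
  exact inv_mul_cancel₀ (hτ k).ne'

/-- **THE SCHUR-FORM CRITERION.**  If `C·B = 0`, every `τ_k > 0`, and the `|ι| × |ι|` Schur complement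
`−L₁₁ − L₁₂·diag(τ)⁻¹·L₁₂ᵀ` is positive semidefinite, then `−𝓛 ⪰ 0` (the `lmi` field of `SlabCertificate` /
`LPSlabCertificate`).  [cite: BoydVandenberghe2004, §A.5.5 (Schur complement); HornJohnson2013, §7.7 Theorem 7.7.7] -/
theorem neg_slabMatrix_posSemidef_of_schur (hCB : S.C * S.B = 0) {P : Matrix ι ι ℝ} {η : ℝ}
    {lam τ a b : κ → ℝ} (hτ : ∀ k, 0 < τ k) (hS : (slabSchur S P η lam τ a b).PosSemidef) :
    (-slabMatrix S P η lam τ a b).PosSemidef := by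
  rw [neg_slabMatrix_eq_fromBlocks_of_C_mul_B S hCB]
  have hD := posDef_diagonal_of_pos hτ
  letI : Invertible (Matrix.diagonal τ) := hD.isUnit.invertible
  have hT : (-slabL12 S P lam τ a b)ᵀ = (-slabL12 S P lam τ a b)ᴴ := by
    rw [Matrix.conjTranspose_eq_transpose_of_trivial]
  rw [hT]
  refine (Matrix.PosDef.fromBlocks₂₂ (-slabL11 S P η τ a b) (-slabL12 S P lam τ a b) hD).2 ?_
  rw [← hT, inv_diagonal_of_pos hτ]
  have e : -slabL11 S P η τ a b - -slabL12 S P lam τ a b * Matrix.diagonal (fun k => (τ k)⁻¹) *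
      (-slabL12 S P lam τ a b)ᵀ = slabSchur S P η lam τ a b := by
    rw [slabSchur, transpose_neg, Matrix.neg_mul, Matrix.neg_mul, Matrix.mul_neg, neg_neg]
  rw [e]; exact hS

/-! ### Constructors -/

/-- **A `SlabCertificate` from Schur-form data** (class of record: `P ⪰ ε·1`, `lam_k > 0 ⇒ a_k ≥ 0`).
[cite: Pai1981, §2.16 Theorem [18] eqs. (2.63)–(2.64); BoydVandenberghe2004, §A.5.5] -/
def SlabCertificate.ofSchur (hCB : S.C * S.B = 0) (P : Matrix ι ι ℝ) (ε η : ℝ) (τ lam a b : κ → ℝ)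
    (P_symm : Pᵀ = P) (ε_pos : 0 < ε) (η_pos : 0 < η)
    (P_ge : (P - ε • (1 : Matrix ι ι ℝ)).PosSemidef) (τ_pos : ∀ k, 0 < τ k) (lam_nonneg : ∀ k, 0 ≤ lam k)
    (a_nonneg_of_lam_pos : ∀ k, 0 < lam k → 0 ≤ a k)
    (schur : (slabSchur S P η lam τ a b).PosSemidef) : SlabCertificate S where
  P := P
  ε := ε
  η := η
  τ := τ
  lam := lam
  a := a
  b := b
  P_symm := P_symm
  ε_pos := ε_pos
  η_pos := η_pos
  P_ge := P_ge
  τ_nonneg := fun k => (τ_pos k).le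
  lam_nonneg := lam_nonneg
  a_nonneg_of_lam_pos := a_nonneg_of_lam_pos
  lmi := neg_slabMatrix_posSemidef_of_schur S hCB τ_pos schur

/-- **An `LPSlabCertificate` from Schur-form data** (positivity class: `P + Cᵀ·diag(λa)·C ⪰ ε·1`, `P` free).
[cite: Khalil2002, §7.1.2 Theorem 7.3; BoydVandenberghe2004, §A.5.5] -/
def LPSlabCertificate.ofSchur (hCB : S.C * S.B = 0) (P : Matrix ι ι ℝ) (ε η : ℝ) (τ lam a b : κ → ℝ)
    (P_symm : Pᵀ = P) (ε_pos : 0 < ε) (η_pos : 0 < η)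
    (lower_ge : (P + S.Cᵀ * Matrix.diagonal (fun k => lam k * a k) * S.C - ε • (1 : Matrix ι ι ℝ)).PosSemidef)
    (τ_pos : ∀ k, 0 < τ k) (lam_nonneg : ∀ k, 0 ≤ lam k)
    (schur : (slabSchur S P η lam τ a b).PosSemidef) : LPSlabCertificate S where
  P := P
  ε := ε
  η := η
  τ := τ
  lam := lam
  a := a
  b := b
  P_symm := P_symm
  ε_pos := ε_pos
  η_pos := η_pos
  lower_ge := lower_ge
  τ_nonneg := fun k => (τ_pos k).le
  lam_nonneg := lam_nonneg
  lmi := neg_slabMatrix_posSemidef_of_schur S hCB τ_pos schur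

/-- The constructor keeps the sector data (definitional). [cite: Khalil2002, §7.1.2 Theorem 7.3] -/
theorem LPSlabCertificate.ofSchur_a_b (hCB : S.C * S.B = 0) (P : Matrix ι ι ℝ) (ε η : ℝ) (τ lam a b : κ → ℝ)
    (P_symm : Pᵀ = P) (ε_pos : 0 < ε) (η_pos : 0 < η)
    (lower_ge : (P + S.Cᵀ * Matrix.diagonal (fun k => lam k * a k) * S.C - ε • (1 : Matrix ι ι ℝ)).PosSemidef)
    (τ_pos : ∀ k, 0 < τ k) (lam_nonneg : ∀ k, 0 ≤ lam k) (schur : (slabSchur S P η lam τ a b).PosSemidef) (k : κ) :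
    (LPSlabCertificate.ofSchur S hCB P ε η τ lam a b P_symm ε_pos η_pos lower_ge τ_pos lam_nonneg schur).a k = a k ∧
    (LPSlabCertificate.ofSchur S hCB P ε η τ lam a b P_symm ε_pos η_pos lower_ge τ_pos lam_nonneg schur).b k = b k :=
  ⟨rfl, rfl⟩

end Literature.MathematicalPhysics.PowerSystems.LyapunovFunctionFamily

end
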